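import Mathlib
import HarnessLib
import HarnessLib.Audit
import Summits.HubbardSuperconductivity.Statement
import Summits.HubbardSuperconductivity.HubbardSuperconductivity.Theses.WidthHaldane
import HarnessLib.Audit.Status.Attr

/-!
Route: SeamInduction

DORMANT since 2026-08-24T06:57:07Z (reconciler: no traction for 6.6 d (last activity item-evidence-added at 2026-08-17T16:30:39Z); parked, not closed — `ledger route dormant route-HubbardSuperconductivity-SeamInduction --off` to reactiv) — unstaffed, not closed; items shared with open routes are served there. `ledger route dormant <id> --off` reactivates.

# Route SeamInduction — width-uniform tube thermodynamics from per-width Luther–Emery data plus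
one-seam locality, by a proved width induction

DECOMPOSITION-FIRST (lens 3.4) on the summit-strength leaf X =
`WidthHaldane.WidthUniformThermodynamics` (stmt-HubbardSuperconductivity-16312,
the judge's hardest crux of the B-ceiling route WidthHaldane: width-UNIFORM twist stiffness per site
ρ̃_(L,M) ≥ d₀ and inverse pair
compressibility 0 < ẽ″_(L,M) ≤ k₀ of the pure Hubbard tubes (ℤ/L)×(ℤ/M), all even widths M₁ ≤ M ≤
L). Typed split, LOCAL + LOCAL-TO-GLOBAL
IN THE WIDTH: X ⇐ Sub₁ ∧ Sub₂ with Sub₁ = PerWidthThermodynamics (the same two bounds for EACH even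
width separately, constants d_M, k_M,
L_M allowed to depend on M: a family of quasi-1D Luther–Emery statements) and Sub₂ =
SeamGluingLocality (for all (U,δ) in the window:
gluing two tubes of even widths M′, M″ ≥ M₂ into one of width M = M′+M″ costs at most a factor 1 −
M₂/M on the positive part of the smaller
stiffness / compressibility and 1 + M₂/M on the larger compressibility). X_of_subs is PROVED (strong
induction on M: base window
[M₁, 2M₁+2] with M₁ = 4M₂+12, unequal-width step M ↦ (2⌊M/4⌋, M − 2⌊M/4⌋), invariants ρ̃_M ≥ d₁(1/4
+ M₂/2M), ẽ″_M ≤ k₁(2 − 4M₂/M),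
positivity pointwise; sorry-free, ~200 lines, inside `closes`), and `closes` = WidthHaldane.closes ∘
X_of_subs with the shared crux
WidthHaldaneBridge (stmt-16311). It suffices to show WidthHaldaneBridge ∧ PerWidthThermodynamics ∧
SeamGluingLocality.
Lean: `WidthHaldaneBridge ∧ PerWidthThermodynamics ∧ SeamGluingLocality`

## Assembly
Kernel-checked, crux-only (Sketch.lean / glue.lean: lean check rc 0, 0 sorries, axioms propext /
Classical.choice / Quot.sound):
`closes (h1 : WidthHaldaneBridge) (h2 : PerWidthThermodynamics) (h3 : SeamGluingLocality) :
HubbardSuperconductivity`. Step (1) is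
an abstract lemma `key` over two response functionals ρ, κ : (L M Λ e U δ) ↦ ℝ — per-width data +
one-seam locality ⇒ width-uniform
bounds — proved by strong induction on the width (non-dependent choice of the per-width constants,
base constants = inf/sup over the
finite base window, canonical carriers Fin (L·M′) for the parts via finProdFinEquiv and
ZMod.finEquiv, real-variable step inequalities
(1 − a/n)(1/4 + a/(n+2)) ≥ 1/4 + a/(2n) for n ≥ 4a+6 and (1 + a/n)(2 − 8a/(n+2)) ≤ 2 − 4a/n for n ≥
6); step (2) instantiates it at the
twist stiffness and the inverse pair compressibility, giving
`WidthHaldane.WidthUniformThermodynamics` by definitional unfolding; step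
(3) applies the parent route's certified `WidthHaldane.closes h1`. All three cruxes are
load-bearing.

Rationale: WHY THIS LINE. WidthHaldane trades 2D U(1) order for a width-indexed family of 1+1-D statements but
leaves its thermodynamic input UNIFORM in the width,
which is where the judge located the unattacked 2D content ("no technique"). Uniformity in M is
exactly what a local-to-global induction
manufactures: the per-width members (Sub₁) are the objects that bosonization computes and 1D
constructive renormalisation proves —
Luttinger-liquid structure, compressibility and Drude-weight (Haldane) relations are THEOREMS for
the non-half-filled Hubbard chain and
non-solvable spinless chains [Mastropietro2005, BenfattoFalcoMastropietro2010,
BenfattoMastropietro2011, Haldane1981], the 2-leg ladder is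
the first open rung [LinBalentsFisher1998, DolfiEtAl2015, NoackWhiteScalapino1996] — while the
crossover physics is isolated in ONE
inequality per gluing (Sub₂), the energy-level form of the inter-ladder Josephson/pair-tunnelling
locking of coupled spin-gapped ladders
[EmeryKivelsonZachar1997, ArrigoniFradkinKivelson2004, LinBalentsFisher1997]. Imported: the
dyadic/induction-on-scales template of
multiscale analysis, run in the WIDTH with an unequal-width step so that every even width is reached
(not only M₀2ʲ), and the a-priori
bookkeeping that summable losses O(M₂/M) along the merge tree keep the constants uniform —
kernel-checked here rather than promised. No
listed route decomposes the thermodynamics crux (WidthHaldane foresaw only the conjunction split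
StiffnessFloor ∧ CompressibilityCeiling and
reserved doubling for EXPONENTS inside its Bridge); the negatives index (stmt-1180, stmt-1314) is
untouched.

RANKED CRUXES. #0 WidthUniformThermodynamics (target) — X — verbatim the rank-3 crux of route
WidthHaldane (stmt-HubbardSuperconductivity-16312; identical signature, the gate attaches this
route): ∃ U>0, δ∈(0,3/10), d₀>0, k₀, M₁, L₀: for all even L ≥ L₀, all even widths M₁ ≤ M ≤ L and
every linearly ordered labelling of the tube, ρ̃_(L,M) ≥ d₀ and 0 < ẽ″_(L,M) ≤ k₀. Here it is NOT a
hypothesis of `closes`: it is DERIVED from PerWidthThermodynamics and SeamGluingLocality (X_of_subs,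
proved inside `closes`). (why it might fail: at every (U, δ<0.3) some widths may be
insulating/striped (ẽ″ → ∞) or envelope-soft (ρ̃ ~ 1/M²); at weak U the needed L₀ ~ sup_M ξ_M is
astronomically large — fatal if sup_M ξ_M = ∞ (inherited from WidthHaldane).)
[ScalapinoWhiteZhang1993, Kohn1964, LinBalentsFisher1997, NoackWhiteScalapino1996, QinEtAl2020]
#2 SeamGluingLocality (crux) — ONE-SEAM LOCALITY (local-to-global piece; carries the
dimensional-crossover difficulty). For every U > 0 and δ ∈ (0,3/10) there are M₂, L₂ such that for
all even L ≥ L₂, all even widths M′, M″ ≥ M₂ with M = M′+M″ ≤ L and all linearly ordered labellings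
of the three tubes (ℤ/L)×(ℤ/M′), (ℤ/L)×(ℤ/M″), (ℤ/L)×(ℤ/M): ρ̃_(L,M) ≥ (1 − M₂/M)·max(min(ρ̃_(L,M′),
ρ̃_(L,M″)), 0), ẽ″_(L,M) ≥ (1 − M₂/M)·max(min(ẽ″_(L,M′), ẽ″_(L,M″)), 0) and ẽ″_(L,M) ≤ (1 +
M₂/M)·max(max(ẽ″_(L,M′), ẽ″_(L,M″)), 0) — the two intensive responses (twist stiffness per site at
θ₀ = π/3 through the long cycle; LM·Δ²_N E/4) of a glued tube are those of its parts up to a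
boundary factor 1 ± M₂/M (positive parts: nothing is claimed from paramagnetic or unstable parts).
Width-indexed, comparison-only: no tube is asserted to be in any phase. [difficulty: XL] (why it
might fail: gluing can change the phase: two C1S0 2-leg ladders make a 4-leg tube with CEX (q_y=π)
pairing or stripes at commensurate (M,δ) (LinBalentsFisher1997 §V), an O(1) jump of the responses
cofinal in M at some (U,δ) defeats every M₂; no variational bound reaches the O(M/L) twist scale.)
[LinBalentsFisher1997, ArrigoniFradkinKivelson2004, EmeryKivelsonZachar1997,
ScalapinoWhiteZhang1993, QinEtAl2020]
#3 PerWidthThermodynamics (crux) — PER-WIDTH LUTHER–EMERY DATA (local piece; the attackable one).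
There are U > 0 and δ ∈ (0,3/10) such that for EVERY even width M ≥ 2 SEPARATELY there are d_M > 0,
k_M and L_M with: for all even L ≥ max(M, L_M) and every linearly ordered labelling of (ℤ/L)×(ℤ/M),
ρ̃_(L,M) ≥ d_M and 0 < ẽ″_(L,M) ≤ k_M — each member is a statement about ONE quasi-1D M-leg tube in
the long-tube limit (finite charge stiffness ∝ Drude weight, no charge gap, no phase separation),
with constants free to degrade with M; uniformity in M is NOT asked (it is manufactured by
SeamGluingLocality + the proved induction). [difficulty: open-problem] (why it might fail: it asks
EVERY even width at ONE (U,δ): a single commensurate (M,δ) tube that is charge-gapped/striped (ẽ″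
unbounded in L) or paramagnetic on the π/3 envelope (shell/parity effects persisting in L) kills it;
already M = 2 is an open constructive-RG problem.) [Mastropietro2005, BenfattoFalcoMastropietro2010,
BenfattoMastropietro2011, DolfiEtAl2015, NoackWhiteScalapino1996, LinBalentsFisher1998,
LedermannLehurRice2000]
#4 WidthHaldaneBridge (crux) — THE HALDANE RELATION CLIMBS THE WIDTH — verbatim the rank-2 crux of
route WidthHaldane (stmt-HubbardSuperconductivity-16311; identical signature, shared): for every U >
0, δ ∈ (0,3/10) and data (d₀, k₀, M₁, L₀), width-uniform thermodynamics of the pure tubes forces the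
Haldane-form law G_ψ(r) ≥ A·L·M²·r̂^(−Ξ/K̂_(L,M)), K̂ = M√(ρ̃/ẽ″), for every sector ground state of
every even tube, with width-uniform Ξ, A. [difficulty: XL] (why it might fail: a stiff, compressible
tube need not be C1S0 in the q_y=0 B1g channel: gapless relative/spin modes (C1Sn) or a
non-d_(x²−y²) condensate at some (U, δ<0.3) with uniform thermodynamics would give exponent ≫ Ξ/K̂
cofinally in M; amplitude uniformity is non-universal.) [BenfattoFalcoMastropietro2010,
BenfattoMastropietro2011, Haldane1981, Mastropietro2005, LinBalentsFisher1997, DolfiEtAl2015]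

TWO-LAYER PLAN. Foreseen (not filed): PerWidthThermodynamics ⇐ PerWidthStiffness (∃(U,δ): ρ̃ per
width) → PerWidthCompressibility (∀(U,δ): 0 < ẽ″ ≤ k_M
per width) → PerWidthThermodynamics (glue proved in the birth skeleton); inside it the ladder M = 2
first (constructive RG with the
SO(8)/large-N Gross–Neveu anchors, LinBalentsFisher1998, KopperMagnenRivasseau1995).
SeamGluingLocality ⇐ StiffnessLocality →
CompressibilityLocality → SeamGluingLocality (glue proved in the birth skeleton); the stiffness half
is the sine-Gordon locking lemma for
the relative phase of two coupled Luther–Emery liquids (single-electron tunnelling spin-gapped, pair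
tunnelling relevant). Provable-now
helpers provers should land first (as --supports): carrier invariance of ρ̃, ẽ″ under relabelling
(Literature SiteBijectionSectorTransport).

KILL CRITERIA. SeamGluingLocality refuted at some (U, δ<3/10) (a proof that gluing changes the
responses by O(1) cofinally in the width — e.g. a
width-periodic CEX/stripe alternation) closes the route `refuted:SeamGluingLocality` unless the
refutation is confined to widths ≡ 2 mod 4
(then ONE restate on widths ≡ 0 mod 4 with the step M ↦ (M/2, M/2)). PerWidthThermodynamics refuted
as typed (every (U,δ) in the window has
an even width whose tube is charge-gapped or envelope-paramagnetic for all large L) ⇒ restate once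
with 'all even widths M ≥ M_*' (the
induction needs only a cofinal base window); refuted again ⇒ close. WidthHaldaneBridge refuted ⇒
this route and WidthHaldane break together
(shared item; follow the parent's pivot). WidthUniformThermodynamics proved directly, or
HubbardSuperconductivity proved elsewhere, moots it.

NOT DECOMPOSED YET. The per-width theorems themselves (M = 2 first), the locking lemma behind
SeamGluingLocality, the quantitative handover width M₂(U,δ), the
treatment of widths below M₂, the witness point (proposal (U,δ) ≈ (4, 1/4), away from (8,1/8)), and
the canonical-carrier reduction are
layer 2; so is any use of unequal splittings other than (2⌊M/4⌋, M − 2⌊M/4⌋).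

CHEAPEST FALSIFIER. DMRG on pure Hubbard tubes (periodic transverse b.c.) of widths M = 2, 4, 6, 8
and lengths L ≤ 96 at (U,δ) = (4, 1/4): measure
E(π/3) − E(0) (hence ρ̃_(L,M)) and Δ²_N E (hence ẽ″). The line dies if (a) some width has ρ̃ ≤ 0 or
ẽ″ growing with L (kills
PerWidthThermodynamics at that point), or (b) the locality inequalities fail at accessible widths
for every small M₂, e.g.
ρ̃_8 < (1 − M₂/8)·min(ρ̃_4, ρ̃_4)₊ or ρ̃_6 < (1 − M₂/6)·min(ρ̃_2, ρ̃_4)₊ with M₂ = 2 (kills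
SeamGluingLocality there). Not runnable in this
seat (no kit in lens mode); DolfiEtAl2015 (M = 2, U = 8) and NoackWhiteScalapino1996 supply the M =
2 instance of per-width data. The
in-Lean checks I could run: all BC probes (C → S, S → C, stub → C, stub → S, exact? dedup) fail as
required.

NUMBERS. Proposal point (U,δ) = (4, 1/4) ∈ (0,∞)×(0,3/10), away from the stripe point (8, 1/8)
[QinEtAl2020]. Probe conventions inherited from
WidthHaldane: θ₀ = π/3, ΔN = 2, N_(L,M) = 2⌊(1−δ)LM/2⌋. Induction constants: M₁ = 4M₂ + 12, base
window [M₁, 2M₁+2], d₀ = d₁/4,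
k₀ = 2k₁. 2-leg ladder: Luther–Emery with K_ρ > 1 at low doping, U = 8 [DolfiEtAl2015]. Items at
open: 5 (3 cruxes, 1 target, 1 assembly).

DEFINITION REQUESTS. None: every item is typed inline over hamiltonian / SimpleGraph.fromRel /
szSector / Matrix.minEnergyOn / annihilation / creation / orb
(the let-prefix of WidthHaldane, verbatim). Later convenience notions (hubbardTube, tubeStiffness,
tubePairCompressibility) may be filed
under Summits/HubbardSuperconductivity/HubbardSuperconductivity/Theorems once provers ask.

Novelty: Searches (2026-08-17): lever table of the 5 ceiling routes + the 32 open routes' cruxes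
(open_routes_cruxes.jsonl) — no route decomposes a
thermodynamic/energy crux by an induction in a geometric parameter; `lean search
'SeamDoubling|NarrowBase|SeamGluing|PerWidth'` (Hubbard: only
WidthHaldane's prose); `ledger negatives --problem HubbardSuperconductivity` (2, unrelated); `lit
search --hybrid "superfluid stiffness
Luttinger parameter N-leg ladder … dimensional crossover"` (10 textbook hits: Fradkin 2013,
Altland–Simons, Xiang–Wu 2022 d-wave SC — no
width theorem); `lit search --source zbmath "dimensional crossover coupled Luttinger liquids
superconductivity"` (1: Cazalilla–Ho–Giamarchi
2006, arXiv:cond-mat/0604525, mean-field/RPA inter-tube coupling for cold atoms); `lit search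
--source s2 "Drude weight Hubbard ladder"`
(8: Sano 1999 HF Luttinger parameters of ladders, transport numerics — no gluing statement); `lit
galaxy search "coupled Luttinger liquids" |
"sliding Luttinger liquid" | "Hubbard ladders" --star all` (textbooks/theses, arXiv:1709.07380
multichannel LL — nothing on energy-response
locality); local `lit search`, OpenAlex, arXiv API were down/429 during the session (logged in
NOTES.md).
Nearest prior art found: LinBalentsFisher1997 (doi:10.1103/physrevb.56.6569, §VI: heuristic
weak-coupling dimensional crossover N → ∞ of
Hubbard ladders), ArrigoniFradkinKivelson2004 (doi:10.1103/physrevb.69.214519: 2D SC from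
Josephson-coupled 2-leg ladders, perturbative in the  [refs: 10.1103/physrevb.56.6569, 10.1103/physrevb.69.214519:, cond-mat/0604525, 1709.07380, doi:10.1103/physrevb.56.6569, doi:10.1103/physrevb.69.214519, LinBalentsFisher1997, ArrigoniFradkinKivelson2004]

Barriers (technique_class: dimensional-crossover, width-induction): - technique_class: dimensional-crossover, width-induction
- Literature.Barriers.HubbardSuperconductivity.HohenbergMerminWagnerPairing: not engaged — both new
cruxes are statements about sector ground-state ENERGIES of finite tubes at T = 0 (no Gibbs state,
no order parameter of a fixed-width system is claimed).
- Literature.Barriers.HubbardSuperconductivity.PositiveTemperatureNoPairLRO: not engaged (T = 0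
throughout; Koma–Tasaki's T>0 decay is consistent with every item).
- Literature.Barriers.HubbardSuperconductivity.LROForcesLowLyingStates: harmless — ρ̃ and ẽ″ are
differences of sector minima, blind to degeneracy and to the Anderson tower (whose charging energy
is ẽ″/(LM)); the every-ground-state clause lives only in the shared Bridge, where WidthHaldane
already answered it.
- Literature.Barriers.HubbardSuperconductivity.GeneralizedHartreeFockNoPairing: not in class — no
quasi-free state; Luther–Emery tubes are non-Gaussian; the induction uses no variational state at
all.
- Literature.Barriers.HubbardSuperconductivity.WeakCouplingCeiling: it bites the CONSTANTS of
PerWidthThermodynamics (L_M ~ ξ_M ~ e^(c/U²) at weak U) and the handover width M₂(U,δ), not the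
statements; the bet is intermediate U ≈ 4 where ξ is a few sites and 1D RG is a strong-coupling flow
with integrable anchors.
- Literature.Barriers.HubbardSuperconductivity.StrongCouplingCeiling: not used (no t/U or high-T
expansion); large U is where stripes threaten PerWidthThermodynamics, handled by the choice of wi

History (route lifecycle, newest last):
- 2026-08-24T06:57:07Z · DORMANT — reconciler: no traction for 6.6 d (last activity item-evidence-added at 2026-08-17T16:30:39Z); parked, not closed — `ledger route dormant route-HubbardSupercond (operator:999:3860405)

sub-problem: HubbardSuperconductivity · status: dormant · opened planner-plan-lens3-HubbardSuperconductivity-decomp-0 2026-08-17T02:40:25Z · rev 0 · ledger route-HubbardSuperconductivity-SeamInduction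
GENERATED by the gate from the ledger (D-0016/17). Provers cite these decls: `theorem foo : Summit.HubbardSuperconductivity.HubbardSuperconductivity.Theses.SeamInduction.<Decl> := …` in Summits/HubbardSuperconductivity/HubbardSuperconductivity/Theorems/<Name>.lean.
-/

namespace Summit.HubbardSuperconductivity.HubbardSuperconductivity.Theses.SeamInduction

open scoped BigOperators Topology Manifold Classical MeasureTheory ProbabilityTheory Matrix InnerProductSpace ComplexConjugate ContinuousMap
open Filter Set Function TopologicalSpace MeasureTheory

attribute [summit_statement] _root_.HubbardSuperconductivity

open Literature.Hubbard

/-- item stmt-HubbardSuperconductivity-16312 · target · rank 0 · open · by planner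
why it might fail: at every (U, δ<0.3) some widths may be insulating/striped (ẽ″ → ∞) or envelope-soft (ρ̃ ~ 1/M²); at weak U the needed L₀ ~ sup_M ξ_M is astronomically large — fatal if sup_M ξ_M = ∞ (inherited from WidthHaldane).
sources: ScalapinoWhiteZhang1993, Kohn1964, LinBalentsFisher1997, NoackWhiteScalapino1996, QinEtAl2020
[crux] WIDTH-UNIFORM STIFFNESS AND COMPRESSIBILITY OF THE PURE MODEL (carrier-free typing, rev 5:
the two energy functionals are invariant under relabelling of the sites, so the added '∀ labellings
e : Λ ≃ ℤ/L × ℤ/M' is free; provers may fix the canonical carrier and transport with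
SiteBijectionSectorTransport). There are U > 0, δ ∈ (0, 3/10), d₀ > 0, k₀, M₁, L₀ such that for all
even L ≥ L₀, all even widths M₁ ≤ M ≤ L and every linearly ordered labelling of the sites, the pure
Hubbard tube Λ_{L,M} at filling N_{L,M} = 2⌊(1−δ)LM/2⌋, S^z = 0, has (i) twist stiffness per site
ρ̃_{L,M} ≥ d₀ (the Byers–Yang/Kohn/Scalapino–White–Zhang superfluid-weight criterion read on the
sector-minimum envelope at the fixed sub-half-flux-quantum twist θ₀ = π/3 through the long cycle, so
that metals, whose envelope flattens after θ ~ 2π/M, and insulators FAIL, uniformly over aspect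
ratios — 1D stiffness ∝ M) and (ii) strictly positive, bounded inverse pair compressibility 0 <
ẽ″_{L,M} ≤ k₀ (no charge gap, no phase separation, smooth even-N staircase). Both are differences of
sector ground-state energies only (blind to degeneracy and towers). [difficulty: XL] -/
@[route_item "route-HubbardSuperconductivity-SeamInduction"]
def WidthUniformThermodynamics : Prop :=
  open Matrix Literature.MathematicalPhysics.QuantumLattice in let H0 : ∀ (L M : ℕ) (Λ : Type) [LinearOrder Λ] [Fintype Λ], (Λ ≃ ZMod L × ZMod M) → ℝ → Matrix (Finset (Orb Λ)) (Finset (Orb Λ)) ℂ := fun _ _ Λ _ _ e U => hamiltonian (SimpleGraph.fromRel fun x y : Λ => y = e.symm ((e x).1 + 1, (e x).2) ∨ y = e.symm ((e x).1, (e x).2 + 1)) 1 U; let Tw : ∀ (L M : ℕ) [NeZero L] [NeZero M] (Λ : Type) [LinearOrder Λ] [Fintype Λ], (Λ ≃ ZMod L × ZMod M) → ℝ → Matrix (Finset (Orb Λ)) (Finset (Orb Λ)) ℂ := fun _ M _ _ _ _ _ e θ => ∑ b : ZMod M, ∑ σ : Fin 2, ((1 - Complex.exp (Complex.I * θ)) •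 (creation (orb (e.symm (0, b)) σ) * annihilation (orb (e.symm (-1, b)) σ)) + (1 - Complex.exp (-(Complex.I * θ))) • (creation (orb (e.symm (-1, b)) σ) * annihilation (orb (e.symm (0, b)) σ))); let E : ∀ (L M : ℕ) [NeZero L] [NeZero M] (Λ : Type) [LinearOrder Λ] [Fintype Λ], (Λ ≃ ZMod L × ZMod M) → ℝ → ℝ → ℕ → ℝ := fun L M _ _ Λ _ _ e U θ N => (H0 L M Λ e U + Tw L M Λ e θ).minEnergyOn (szSector N 0); let Np : ℕ → ℕ → ℝ → ℕ := fun L M δ => 2 * ⌊(1 - δ) * ((L : ℝ) * (M : ℝ)) / 2⌋₊; let stiff : ∀ (L M : ℕ) [NeZero L] [NeZero M] (Λ : Type) [LinearOrder Λ] [Fintype Λ], (Λ ≃ ZMod L × ZMod M) → ℝ → ℝ → ℝ := fun L M _ _ Λ _ _ e U δ => 2 * (L : ℝ) * (E L M Λ e U (Real.pi / 3) (Np L M δ) - E L M Λ e U 0 (Np L M δ)) / ((Real.pi / 3) ^ 2 * (M : ℝ)); let icomp : ∀ (L M : ℕ) [NeZero L] [NeZero M] (Λ : Type) [LinearOrder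 Λ] [Fintype Λ], (Λ ≃ ZMod L × ZMod M) → ℝ → ℝ → ℝ := fun L M _ _ Λ _ _ e U δ => (L : ℝ) * (M : ℝ) * (E L M Λ e U 0 (Np L M δ + 2) + E L M Λ e U 0 (Np L M δ - 2) - 2 * E L M Λ e U 0 (Np L M δ)) / 4; ∃ U : ℝ, 0 < U ∧ ∃ δ ∈ Set.Ioo (0 : ℝ) (3 / 10), ∃ d₀ : ℝ, 0 < d₀ ∧ ∃ k₀ : ℝ, ∃ M₁ L₀ : ℕ, ∀ (L M : ℕ) [NeZero L] [NeZero M], Even L → Even M → M₁ ≤ M → M ≤ L → L₀ ≤ L → ∀ (Λ : Type) [LinearOrder Λ] [Fintype Λ] (e : Λ ≃ ZMod L × ZMod M), d₀ ≤ stiff L M Λ e U δ ∧ 0 < icomp L M Λ e U δ ∧ icomp L M Λ e U δ ≤ k₀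

/-- item stmt-HubbardSuperconductivity-18509 · crux · rank 2 · open · by planner
why it might fail: gluing can change the phase: two C1S0 2-leg ladders make a 4-leg tube with CEX (q_y=π) pairing or stripes at commensurate (M,δ) (LinBalentsFisher1997 §V), an O(1) jump of the responses cofinal in M at some (U,δ) defeats every M₂; no variational bound reaches the O(M/L) twist scale.
sources: LinBalentsFisher1997, ArrigoniFradkinKivelson2004, EmeryKivelsonZachar1997, ScalapinoWhiteZhang1993, QinEtAl2020
[crux] ONE-SEAM LOCALITY (local-to-global piece; carries the dimensional-crossover difficulty). For
every U > 0 and δ ∈ (0,3/10) there are M₂, L₂ such that for all even L ≥ L₂, all even widths M′, M″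
≥ M₂ with M = M′+M″ ≤ L and all linearly ordered labellings of the three tubes (ℤ/L)×(ℤ/M′),
(ℤ/L)×(ℤ/M″), (ℤ/L)×(ℤ/M): ρ̃_(L,M) ≥ (1 − M₂/M)·max(min(ρ̃_(L,M′), ρ̃_(L,M″)), 0), ẽ″_(L,M) ≥ (1 −
M₂/M)·max(min(ẽ″_(L,M′), ẽ″_(L,M″)), 0) and ẽ″_(L,M) ≤ (1 + M₂/M)·max(max(ẽ″_(L,M′), ẽ″_(L,M″)), 0)
— the two intensive responses (twist stiffness per site at θ₀ = π/3 through the long cycle; LM·Δ²_N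
E/4) of a glued tube are those of its parts up to a boundary factor 1 ± M₂/M (positive parts:
nothing is claimed from paramagnetic or unstable parts). Width-indexed, comparison-only: no tube is
asserted to be in any phase. [difficulty: XL] -/
@[route_item "route-HubbardSuperconductivity-SeamInduction", crux]
def SeamGluingLocality : Prop :=
  open Matrix Literature.MathematicalPhysics.QuantumLattice in let H0 : ∀ (L M : ℕ) (Λ : Type) [LinearOrder Λ] [Fintype Λ], (Λ ≃ ZMod L × ZMod M) → ℝ → Matrix (Finset (Orb Λ)) (Finset (Orb Λ)) ℂ := fun _ _ Λ _ _ e U => hamiltonian (SimpleGraph.fromRel fun x y : Λ => y = e.symm ((e x).1 + 1, (e x).2) ∨ y = e.symm ((e x).1, (e x).2 + 1)) 1 U; let Tw : ∀ (L M : ℕ) [NeZero L] [NeZero M] (Λ : Type) [LinearOrder Λ] [Fintype Λ], (Λ ≃ ZMod L × ZMod M) → ℝ → Matrix (Finset (Orb Λ)) (Finset (Orb Λ)) ℂ := fun _ M _ _ _ _ _ e θ => ∑ b : ZMod M, ∑ σ : Fin 2, ((1 - Complex.exp (Complex.I * θ)) • (creation (orb (e.symm (0, b)) σ) * annihilation (orb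 (e.symm (-1, b)) σ)) + (1 - Complex.exp (-(Complex.I * θ))) • (creation (orb (e.symm (-1, b)) σ) * annihilation (orb (e.symm (0, b)) σ))); let E : ∀ (L M : ℕ) [NeZero L] [NeZero M] (Λ : Type) [LinearOrder Λ] [Fintype Λ], (Λ ≃ ZMod L × ZMod M) → ℝ → ℝ → ℕ → ℝ := fun L M _ _ Λ _ _ e U θ N => (H0 L M Λ e U + Tw L M Λ e θ).minEnergyOn (szSector N 0); let Np : ℕ → ℕ → ℝ → ℕ := fun L M δ => 2 * ⌊(1 - δ) * ((L : ℝ) * (M : ℝ)) / 2⌋₊; let stiff : ∀ (L M : ℕ) [NeZero L] [NeZero M] (Λ : Type) [LinearOrder Λ] [Fintype Λ], (Λ ≃ ZMod L × ZMod M) → ℝ → ℝ → ℝ := fun L M _ _ Λ _ _ e U δ => 2 * (L : ℝ) * (E L M Λ e U (Real.pi / 3) (Np L M δ) - E L M Λ e U 0 (Np L M δ)) / ((Real.pi / 3) ^ 2 * (M : ℝ)); let icomp : ∀ (L M : ℕ) [NeZero L] [NeZero M] (Λ : Type) [LinearOrder Λ] [Fintype Λ], (Λ ≃ ZMod L ×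 ZMod M) → ℝ → ℝ → ℝ := fun L M _ _ Λ _ _ e U δ => (L : ℝ) * (M : ℝ) * (E L M Λ e U 0 (Np L M δ + 2) + E L M Λ e U 0 (Np L M δ - 2) - 2 * E L M Λ e U 0 (Np L M δ)) / 4; ∀ U : ℝ, 0 < U → ∀ δ ∈ Set.Ioo (0 : ℝ) (3 / 10), ∃ M₂ L₂ : ℕ, ∀ (L M' M'' M : ℕ) [NeZero L] [NeZero M'] [NeZero M''] [NeZero M], Even L → Even M' → Even M'' → M₂ ≤ M' → M₂ ≤ M'' → M' + M'' = M → M ≤ L → L₂ ≤ L → ∀ (Λ' : Type) [LinearOrder Λ'] [Fintype Λ'] (e' : Λ' ≃ ZMod L × ZMod M') (Λ'' : Type) [LinearOrder Λ''] [Fintype Λ''] (e'' : Λ'' ≃ ZMod L × ZMod M'') (Λ : Type) [LinearOrder Λ] [Fintype Λ] (e : Λ ≃ ZMod L × ZMod M), (1 - (M₂ : ℝ) / M) * max (min (stiff L M' Λ' e' U δ) (stiff L M'' Λ'' e'' U δ)) 0 ≤ stiff L M Λ e U δ ∧ (1 - (M₂ : ℝ) / M) * max (min (icomp L M' Λ'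 e' U δ) (icomp L M'' Λ'' e'' U δ)) 0 ≤ icomp L M Λ e U δ ∧ icomp L M Λ e U δ ≤ (1 + (M₂ : ℝ) / M) * max (max (icomp L M' Λ' e' U δ) (icomp L M'' Λ'' e'' U δ)) 0

/-- item stmt-HubbardSuperconductivity-18510 · crux · rank 3 · open · by planner
why it might fail: it asks EVERY even width at ONE (U,δ): a single commensurate (M,δ) tube that is charge-gapped/striped (ẽ″ unbounded in L) or paramagnetic on the π/3 envelope (shell/parity effects persisting in L) kills it; already M = 2 is an open constructive-RG problem.
sources: Mastropietro2005, BenfattoFalcoMastropietro2010, BenfattoMastropietro2011, DolfiEtAl2015, NoackWhiteScalapino1996, LinBalentsFisher1998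
[crux] PER-WIDTH LUTHER–EMERY DATA (local piece; the attackable one). There are U > 0 and δ ∈
(0,3/10) such that for EVERY even width M ≥ 2 SEPARATELY there are d_M > 0, k_M and L_M with: for
all even L ≥ max(M, L_M) and every linearly ordered labelling of (ℤ/L)×(ℤ/M), ρ̃_(L,M) ≥ d_M and 0 <
ẽ″_(L,M) ≤ k_M — each member is a statement about ONE quasi-1D M-leg tube in the long-tube limit
(finite charge stiffness ∝ Drude weight, no charge gap, no phase separation), with constants free to
degrade with M; uniformity in M is NOT asked (it is manufactured by SeamGluingLocality + the proved
induction). [difficulty: open-problem] -/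
@[route_item "route-HubbardSuperconductivity-SeamInduction", crux]
def PerWidthThermodynamics : Prop :=
  open Matrix Literature.MathematicalPhysics.QuantumLattice in let H0 : ∀ (L M : ℕ) (Λ : Type) [LinearOrder Λ] [Fintype Λ], (Λ ≃ ZMod L × ZMod M) → ℝ → Matrix (Finset (Orb Λ)) (Finset (Orb Λ)) ℂ := fun _ _ Λ _ _ e U => hamiltonian (SimpleGraph.fromRel fun x y : Λ => y = e.symm ((e x).1 + 1, (e x).2) ∨ y = e.symm ((e x).1, (e x).2 + 1)) 1 U; let Tw : ∀ (L M : ℕ) [NeZero L] [NeZero M] (Λ : Type) [LinearOrder Λ] [Fintype Λ], (Λ ≃ ZMod L × ZMod M) → ℝ → Matrix (Finset (Orb Λ)) (Finset (Orb Λ)) ℂ := fun _ M _ _ _ _ _ e θ => ∑ b : ZMod M, ∑ σ : Fin 2, ((1 - Complex.exp (Complex.I * θ)) • (creation (orb (e.symm (0, b)) σ) * annihilation (orb (e.symm (-1, b)) σ)) + (1 - Complex.exp (-(Complex.I * θ))) • (creation (orb (e.symm (-1, b)) σ) * annihilation (orb (e.symm (0, b)) σ))); let E : ∀ (L M : ℕ)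 [NeZero L] [NeZero M] (Λ : Type) [LinearOrder Λ] [Fintype Λ], (Λ ≃ ZMod L × ZMod M) → ℝ → ℝ → ℕ → ℝ := fun L M _ _ Λ _ _ e U θ N => (H0 L M Λ e U + Tw L M Λ e θ).minEnergyOn (szSector N 0); let Np : ℕ → ℕ → ℝ → ℕ := fun L M δ => 2 * ⌊(1 - δ) * ((L : ℝ) * (M : ℝ)) / 2⌋₊; let stiff : ∀ (L M : ℕ) [NeZero L] [NeZero M] (Λ : Type) [LinearOrder Λ] [Fintype Λ], (Λ ≃ ZMod L × ZMod M) → ℝ → ℝ → ℝ := fun L M _ _ Λ _ _ e U δ => 2 * (L : ℝ) * (E L M Λ e U (Real.pi / 3) (Np L M δ) - E L M Λ e U 0 (Np L M δ)) / ((Real.pi / 3) ^ 2 * (M : ℝ)); let icomp : ∀ (L M : ℕ) [NeZero L] [NeZero M] (Λ : Type) [LinearOrder Λ] [Fintype Λ], (Λ ≃ ZMod L × ZMod M) → ℝ → ℝ → ℝ := fun L M _ _ Λ _ _ e U δ => (L : ℝ) * (M : ℝ) * (E L M Λ e U 0 (Np L M δ + 2) + E L M Λ e U 0 (Np L M δ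 - 2) - 2 * E L M Λ e U 0 (Np L M δ)) / 4; ∃ U : ℝ, 0 < U ∧ ∃ δ ∈ Set.Ioo (0 : ℝ) (3 / 10), ∀ (M : ℕ) [NeZero M], Even M → 2 ≤ M → ∃ d : ℝ, 0 < d ∧ ∃ k : ℝ, ∃ L₁ : ℕ, ∀ (L : ℕ) [NeZero L], Even L → M ≤ L → L₁ ≤ L → ∀ (Λ : Type) [LinearOrder Λ] [Fintype Λ] (e : Λ ≃ ZMod L × ZMod M), d ≤ stiff L M Λ e U δ ∧ 0 < icomp L M Λ e U δ ∧ icomp L M Λ e U δ ≤ k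

/-- item stmt-HubbardSuperconductivity-16311 · crux · rank 4 · open · by planner
why it might fail: a stiff, compressible tube need not be C1S0 in the q_y=0 B1g channel: gapless relative/spin modes (C1Sn) or a non-d_(x²−y²) condensate at some (U, δ<0.3) with uniform thermodynamics would give exponent ≫ Ξ/K̂ cofinally in M; amplitude uniformity is non-universal.
sources: BenfattoFalcoMastropietro2010, BenfattoMastropietro2011, Haldane1981, Mastropietro2005, LinBalentsFisher1997, DolfiEtAl2015
[crux] THE HALDANE RELATION CLIMBS THE WIDTH (carrier-free typing, rev 5: hypothesis and conclusion
quantify over all linearly ordered labellings e : Λ ≃ ℤ/L × ℤ/M of the tube; equivalent to the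
fixed-carrier rev-1 statement by relabelling invariance of sector energies, sector ground states and
expectations). For every U > 0 and δ ∈ (0, 3/10) (the d_{x²−y²} doping window of the t'=0 band) and
all data (d₀ > 0, k₀, M₁, L₀): IF the pure-model tubes have width-uniform thermodynamics — twist
stiffness per site ρ̃_{L,M}(U,δ) := 2L[E_{L,M}(θ=π/3) − E_{L,M}(0)]/((π/3)²M) ≥ d₀ and inverse pair
compressibility 0 < ẽ″_{L,M} := LM[E(N+2)+E(N−2)−2E(N)]/4 ≤ k₀ for all even M₁ ≤ M ≤ L, L ≥ L₀ and
all labellings (E = sector minima `minEnergyOn (szSector · 0)` of the tube Hamiltonian, the twist θ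
entering as the seam Peierls phase e^{±iθ} on the M bonds between the columns of long coordinate −1
and 0) — THEN there are Ξ > 0, A > 0, R, M₂, L₁ such that every normalised sector ground state of
every even tube (M₂ ≤ M ≤ L, L ≥ L₁, any labelling) obeys the Haldane-form law G_ψ(r) ≥
A·L·M²·r̂^{−Ξ√(ẽ″_{L,M}/ρ̃_{L,M})/M} = A·L·M²·r̂^{−Ξ/K̂_{L,M}}, K̂ := M√(ρ̃/ẽ″), for R ≤ r̂: the
column pair exponent is b -/
@[route_item "route-HubbardSuperconductivity-SeamInduction", crux]
def WidthHaldaneBridge : Prop :=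
  open Matrix Literature.MathematicalPhysics.QuantumLattice in let H0 : ∀ (L M : ℕ) (Λ : Type) [LinearOrder Λ] [Fintype Λ], (Λ ≃ ZMod L × ZMod M) → ℝ → Matrix (Finset (Orb Λ)) (Finset (Orb Λ)) ℂ := fun _ _ Λ _ _ e U => hamiltonian (SimpleGraph.fromRel fun x y : Λ => y = e.symm ((e x).1 + 1, (e x).2) ∨ y = e.symm ((e x).1, (e x).2 + 1)) 1 U; let Tw : ∀ (L M : ℕ) [NeZero L] [NeZero M] (Λ : Type) [LinearOrder Λ] [Fintype Λ], (Λ ≃ ZMod L × ZMod M) → ℝ → Matrix (Finset (Orb Λ)) (Finset (Orb Λ)) ℂ := fun _ M _ _ _ _ _ e θ => ∑ b : ZMod M, ∑ σ : Fin 2, ((1 - Complex.exp (Complex.I * θ)) • (creation (orb (e.symm (0, b)) σ) * annihilation (orb (e.symm (-1, b)) σ)) + (1 - Complex.exp (-(Complex.I * θ))) • (creation (orb (e.symm (-1, b)) σ) * annihilation (orb (e.symm (0, b)) σ))); let E : ∀ (L M : ℕ) [NeZero L] [NeZero M] (Λ : Type) [LinearOrder Λ] [Fintype Λ], (Λ ≃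 ZMod L × ZMod M) → ℝ → ℝ → ℕ → ℝ := fun L M _ _ Λ _ _ e U θ N => (H0 L M Λ e U + Tw L M Λ e θ).minEnergyOn (szSector N 0); let Np : ℕ → ℕ → ℝ → ℕ := fun L M δ => 2 * ⌊(1 - δ) * ((L : ℝ) * (M : ℝ)) / 2⌋₊; let stiff : ∀ (L M : ℕ) [NeZero L] [NeZero M] (Λ : Type) [LinearOrder Λ] [Fintype Λ], (Λ ≃ ZMod L × ZMod M) → ℝ → ℝ → ℝ := fun L M _ _ Λ _ _ e U δ => 2 * (L : ℝ) * (E L M Λ e U (Real.pi / 3) (Np L M δ) - E L M Λ e U 0 (Np L M δ)) / ((Real.pi / 3) ^ 2 * (M : ℝ)); let icomp : ∀ (L M : ℕ) [NeZero L] [NeZero M] (Λ : Type) [LinearOrder Λ] [Fintype Λ], (Λ ≃ ZMod L × ZMod M) → ℝ → ℝ → ℝ := fun L M _ _ Λ _ _ e U δ => (L : ℝ) * (M : ℝ) * (E L M Λ e U 0 (Np L M δ + 2) + E L M Λ e U 0 (Np L M δ - 2) - 2 * E L M Λ e U 0 (Np L M δ)) / 4; let P : ∀ (L M : ℕ) (Λ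 : Type) [LinearOrder Λ] [Fintype Λ], (Λ ≃ ZMod L × ZMod M) → Λ → Matrix (Finset (Orb Λ)) (Finset (Orb Λ)) ℂ := fun _ _ Λ _ _ e x => ∑ j : Fin 4, (((![1, 1, -1, -1] : Fin 4 → ℝ) j / Real.sqrt 2 : ℝ) : ℂ) • (annihilation (orb x 0) * annihilation (orb ((![e.symm ((e x).1 + 1, (e x).2), e.symm ((e x).1 - 1, (e x).2), e.symm ((e x).1, (e x).2 + 1), e.symm ((e x).1, (e x).2 - 1)] : Fin 4 → Λ) j) 1) - annihilation (orb x 1) * annihilation (orb ((![e.symm ((e x).1 + 1, (e x).2), e.symm ((e x).1 - 1, (e x).2), e.symm ((e x).1, (e x).2 + 1), e.symm ((e x).1, (e x).2 - 1)] : Fin 4 → Λ) j) 0)); let G : ∀ (L M : ℕ) [NeZero L] [NeZero M] (Λ : Type) [LinearOrder Λ] [Fintype Λ], (Λ ≃ ZMod L × ZMod M) → Fock (Orb Λ) → ZMod L → ℝ := fun L M _ _ Λ _ _ e ψ r => ∑ a : ZMod L, (expect ((∑ b : ZMod M, P L M Λ e (e.symm (a, b)))ᴴ * (∑ b : ZMod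 M, P L M Λ e (e.symm (a + r, b)))) ψ).re; ∀ U : ℝ, 0 < U → ∀ δ ∈ Set.Ioo (0 : ℝ) (3 / 10), ∀ (d₀ k₀ : ℝ) (M₁ L₀ : ℕ), 0 < d₀ → (∀ (L M : ℕ) [NeZero L] [NeZero M], Even L → Even M → M₁ ≤ M → M ≤ L → L₀ ≤ L → ∀ (Λ : Type) [LinearOrder Λ] [Fintype Λ] (e : Λ ≃ ZMod L × ZMod M), d₀ ≤ stiff L M Λ e U δ ∧ 0 < icomp L M Λ e U δ ∧ icomp L M Λ e U δ ≤ k₀) → ∃ Ξ : ℝ, 0 < Ξ ∧ ∃ A : ℝ, 0 < A ∧ ∃ R M₂ L₁ : ℕ, ∀ (L M : ℕ) [NeZero L] [NeZero M], Even L → Even M → M₂ ≤ M → M ≤ L → L₁ ≤ L → ∀ (Λ : Type) [LinearOrder Λ] [Fintype Λ] (e : Λ ≃ ZMod L × ZMod M), ∀ ψ : Fock (Orb Λ), star ψ ⬝ᵥ ψ = 1 → IsGroundStateInSector (H0 L M Λ e U) (Np L M δ) 0 ψ → ∀ r : ZMod L, R ≤ r.val → r.val + R ≤ L → A * (L : ℝ)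 * (M : ℝ) ^ 2 * ((min r.val (L - r.val) : ℕ) : ℝ) ^ (-(Ξ * Real.sqrt (icomp L M Λ e U δ / stiff L M Λ e U δ) / (M : ℝ))) ≤ G L M Λ e ψ r

/-- item stmt-HubbardSuperconductivity-18511 · assembly · rank 1 · closed · proved by Summit.HubbardSuperconductivity.HubbardSuperconductivity.Theorems.seamInduction_assembly_proof @ ef8bf38596dd (prover) · by planner
sources: Scalapino1995, LinBalentsFisher1997
[assembly] WidthHaldaneBridge → PerWidthThermodynamics → SeamGluingLocality →
HubbardSuperconductivity. -/
@[route_item "route-HubbardSuperconductivity-SeamInduction"]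
def Assembly : Prop :=
  WidthHaldaneBridge → PerWidthThermodynamics → SeamGluingLocality → _root_.HubbardSuperconductivity

/-! D-0027 §2.1 — DECIDING THEOREM (planner-authored via `route open/edit --closes-file`; by planner-plan-lens3-HubbardSuperconductivity-decomp-0 2026-08-17T02:40:25Z):
its hypotheses are this route's items and its conclusion the sub-problem Statement (glue_lint), and it elaborates with this file. -/

@[closes "route-HubbardSuperconductivity-SeamInduction"] theorem closes (h1 : WidthHaldaneBridge) (h2 : PerWidthThermodynamics) (h3 : SeamGluingLocality) :
    _root_.HubbardSuperconductivity := by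
  -- (1) `key`: abstract width induction (per-width data + one-seam locality ⇒ width-uniform bounds);
  -- (2) instantiated by unification it IS `WidthHaldane.WidthUniformThermodynamics` (X_of_subs); (3) parent glue.
  have key : ∀ (ρ κ : ∀ (L M : ℕ) [NeZero L] [NeZero M] (Λ : Type) [LinearOrder Λ] [Fintype Λ], (Λ ≃ ZMod L × ZMod M) → ℝ → ℝ → ℝ), (∃ U : ℝ, 0 < U ∧ ∃ δ ∈ Set.Ioo (0:ℝ) (3/10), ∀ (M : ℕ) [NeZero M], Even M → 2 ≤ M → ∃ d : ℝ, 0 < d ∧ ∃ k : ℝ, ∃ L₁ : ℕ, ∀ (L : ℕ) [NeZero L], Even L → M ≤ L → L₁ ≤ L → ∀ (Λ : Type) [LinearOrder Λ] [Fintype Λ] (e : Λ ≃ ZMod L × ZMod M), d ≤ ρ L M Λ e U δ ∧ 0 < κ L M Λ e U δ ∧ κ L M Λ e U δ ≤ k) → (∀ U : ℝ, 0 < U → ∀ δ ∈ Set.Ioo (0:ℝ) (3/10), ∃ M₂ L₂ : ℕ, ∀ (L M' M'' M : ℕ) [NeZero L] [NeZero M'] [NeZero M''] [NeZero M], Even L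 → Even M' → Even M'' → M₂ ≤ M' → M₂ ≤ M'' → M' + M'' = M → M ≤ L → L₂ ≤ L → ∀ (Λ' : Type) [LinearOrder Λ'] [Fintype Λ'] (e' : Λ' ≃ ZMod L × ZMod M') (Λ'' : Type) [LinearOrder Λ''] [Fintype Λ''] (e'' : Λ'' ≃ ZMod L × ZMod M'') (Λ : Type) [LinearOrder Λ] [Fintype Λ] (e : Λ ≃ ZMod L × ZMod M), (1 - (M₂ : ℝ) / M) * max (min (ρ L M' Λ' e' U δ) (ρ L M'' Λ'' e'' U δ)) 0 ≤ ρ L M Λ e U δ ∧ (1 - (M₂ : ℝ) / M) * max (min (κ L M' Λ' e' U δ) (κ L M'' Λ'' e'' U δ)) 0 ≤ κ L M Λ e U δ ∧ κ L M Λ e U δ ≤ (1 + (M₂ : ℝ) / M) * max (max (κ L M' Λ' e' U δ) (κ L M'' Λ'' e'' U δ)) 0) → ∃ U : ℝ, 0 < U ∧ ∃ δ ∈ Set.Ioo (0 : ℝ) (3 / 10), ∃ d₀ : ℝ, 0 < d₀ ∧ ∃ k₀ : ℝ, ∃ M₁ L₀ : ℕ, ∀ (L M : ℕ) [NeZero L]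 [NeZero M], Even L → Even M → M₁ ≤ M → M ≤ L → L₀ ≤ L → ∀ (Λ : Type) [LinearOrder Λ] [Fintype Λ] (e : Λ ≃ ZMod L × ZMod M), d₀ ≤ ρ L M Λ e U δ ∧ 0 < κ L M Λ e U δ ∧ κ L M Λ e U δ ≤ k₀ := by
    intro ρ κ hA hB
    obtain ⟨U, hU, δ, hδ, hA⟩ := hA
    obtain ⟨M₂, L₂, hB⟩ := hB U hU δ hδ
    have hA' : ∀ M : ℕ, ∃ d : ℝ, ∃ k : ℝ, ∃ L₁ : ℕ, Even M → 2 ≤ M → 0 < d ∧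
        ∀ L : ℕ, Even L → M ≤ L → L₁ ≤ L → ∀ (iL : NeZero L) (iM : NeZero M)
          (Λ : Type) [LinearOrder Λ] [Fintype Λ] (e : Λ ≃ ZMod L × ZMod M),
            d ≤ ρ L M Λ e U δ ∧ 0 < κ L M Λ e U δ ∧ κ L M Λ e U δ ≤ k := by
      intro M
      by_cases h : Even M ∧ 2 ≤ M
      · haveI : NeZero M := ⟨by omega⟩
        obtain ⟨d, hd, k, L₁, h1⟩ := hA M h.1 h.2
        exact ⟨d, k, L₁, fun _ _ => ⟨hd, fun L hLe hML hL1 iL iM Λ _ _ e => h1 L hLe hML hL1 Λ e⟩⟩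
      · exact ⟨1, 1, 0, fun h1 h2 => (h ⟨h1, h2⟩).elim⟩
    choose d k L₁ hd using hA'
    set a : ℝ := (M₂ : ℝ) with ha'
    have ha : 0 ≤ a := by positivity
    set M₁ : ℕ := 4 * M₂ + 12 with hM₁
    set I : Finset ℕ := Finset.range (M₁ / 2 + 2) with hI
    have hI0 : I.Nonempty := ⟨0, by simp [hI]⟩
    set w : ℕ → ℕ := fun i => M₁ + 2 * i with hw
    set d₁ : ℝ := I.inf' hI0 (fun i => d (w i)) with hd₁
    set k₁ : ℝ := I.sup' hI0 (fun i => k (w i))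
    set L₀ : ℕ := max (I.sup (fun i => L₁ (w i))) L₂
    have hwE : ∀ i, Even (w i) := fun i => ⟨2 * M₂ + 6 + i, by simp [hw, hM₁]; ring⟩
    have hw2 : ∀ i, 2 ≤ w i := fun i => by simp only [hw]; omega
    have hp : 0 < d₁ := by
      rw [hd₁, Finset.lt_inf'_iff]; exact fun i _ => (hd (w i) (hwE i) (hw2 i)).1
    have hdl : ∀ i ∈ I, d₁ ≤ d (w i) := fun i hi => Finset.inf'_le _ hi
    have hkg : ∀ i ∈ I, k (w i) ≤ k₁ := fun i hi => Finset.le_sup' (fun i => k (w i)) hi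
    have hLb : ∀ i ∈ I, L₁ (w i) ≤ L₀ := fun i hi =>
      (Finset.le_sup (f := fun i => L₁ (w i)) hi).trans (le_max_left _ _)
    have hM₁a : 4 * a + 12 = (M₁ : ℝ) := by simp only [hM₁, ha']; push_cast; ring
    have car : ∀ (L M : ℕ) [NeZero L] [NeZero M], ∃ e : Fin (L * M) ≃ ZMod L × ZMod M, True :=
      fun L M _ _ => ⟨finProdFinEquiv.symm.trans
        (Equiv.prodCongr (ZMod.finEquiv L).toEquiv (ZMod.finEquiv M).toEquiv), trivial⟩
    have hk0 : 0 ≤ k₁ := by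
      obtain ⟨_, hb⟩ := hd (w 0) (hwE 0) (hw2 0)
      have hw0 := hw2 0
      haveI : NeZero (w 0) := ⟨by omega⟩
      haveI : NeZero (2 * (w 0 + L₁ (w 0))) := ⟨by omega⟩
      obtain ⟨e, -⟩ := car (2 * (w 0 + L₁ (w 0))) (w 0)
      obtain ⟨-, h2, h3⟩ := hb (2 * (w 0 + L₁ (w 0))) (even_two_mul _) (by omega) (by omega)
        inferInstance inferInstance _ e
      exact (h2.le.trans h3).trans (hkg 0 (by simp [hI]))
    have slo : ∀ n : ℝ, 4 * a + 6 ≤ n → 0 < n →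
        1 / 4 + a / (2 * n) ≤ (1 - a / n) * (1 / 4 + a / (n + 2)) := by
      intro n hn hn0
      have e1 : (1 - a / n) * (1 / 4 + a / (n + 2)) - (1 / 4 + a / (2 * n)) =
          a * ((n - 6) - 4 * a) / (4 * n * (n + 2)) := by field_simp; ring
      have : 0 ≤ a * ((n - 6) - 4 * a) / (4 * n * (n + 2)) :=
        div_nonneg (mul_nonneg ha (by linarith)) (by positivity)
      linarith
    have shi : ∀ n : ℝ, 6 ≤ n → 0 < n → (1 + a / n) * (2 - 8 * a / (n + 2)) ≤ 2 - 4 * a / n := by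
      intro n hn hn0
      have e1 : (2 - 4 * a / n) - (1 + a / n) * (2 - 8 * a / (n + 2)) =
          a * (2 * n - 12 + 8 * a) / (n * (n + 2)) := by field_simp; ring
      have : 0 ≤ a * (2 * n - 12 + 8 * a) / (n * (n + 2)) :=
        div_nonneg (mul_nonneg ha (by nlinarith)) (by positivity)
      linarith
    have mlo : ∀ m n : ℝ, 0 < m → 2 * m ≤ n + 2 → a / (n + 2) ≤ a / (2 * m) :=
      fun m n hm hmn => div_le_div_of_nonneg_left ha (by positivity) hmn
    have mhi : ∀ m n : ℝ, 0 < m → 2 * m ≤ n + 2 → 2 - 4 * a / m ≤ 2 - 8 * a / (n + 2) := by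
      intro m n hm hmn
      have : 8 * a / (n + 2) ≤ 4 * a / m := by
        rw [div_le_div_iff₀ (by linarith) hm]; nlinarith
      linarith
    have main : ∀ M : ℕ, Even M → M₁ ≤ M → ∀ L : ℕ, Even L → M ≤ L → L₀ ≤ L →
        ∀ (iL : NeZero L) (iM : NeZero M) (Λ : Type) [LinearOrder Λ] [Fintype Λ]
          (e : Λ ≃ ZMod L × ZMod M),
          d₁ * (1 / 4 + a / (2 * M)) ≤ ρ L M Λ e U δ ∧ 0 < κ L M Λ e U δ ∧
            κ L M Λ e U δ ≤ k₁ * (2 - 4 * a / M) := by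
      intro M
      induction M using Nat.strong_induction_on with
      | _ M ih =>
        intro hMe hM₁M L hLe hML hL₀L iL iM Λ _ _ e
        obtain ⟨r, hr⟩ := hMe
        have hM0 : (0 : ℝ) < M := by exact_mod_cast (show 0 < M by omega)
        have hM₁R : (M₁ : ℝ) ≤ M := by exact_mod_cast hM₁M
        have hL₂L : L₂ ≤ L := le_trans (le_max_right _ _) hL₀L
        by_cases hb : M ≤ 2 * M₁ + 2
        · obtain ⟨i, hiI, hwi⟩ : ∃ i ∈ I, w i = M :=
            ⟨(M - M₁) / 2, by simp only [hI, Finset.mem_range]; omega, by simp only [hw]; omega⟩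
          subst hwi
          obtain ⟨h1, h2, h3⟩ := (hd (w i) (hwE i) (hw2 i)).2 L hLe hML ((hLb i hiI).trans hL₀L) iL iM Λ e
          refine ⟨?_, h2, h3.trans ((hkg i hiI).trans (le_mul_of_one_le_right hk0 ?_))⟩
          · have : a / (2 * (w i : ℝ)) ≤ 1 / 2 := by rw [div_le_iff₀ (by positivity)]; linarith
            calc d₁ * (1 / 4 + a / (2 * (w i : ℝ))) ≤ d₁ * 1 := mul_le_mul_of_nonneg_left (by linarith) hp.le
              _ ≤ _ := by rw [mul_one]; exact (hdl i hiI).trans h1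
          · have : 4 * a / (w i : ℝ) ≤ 1 := by rw [div_le_iff₀ hM0]; linarith
            linarith
        · replace hb := not_le.mp hb
          have hbR : (2 * (M₁ : ℝ) + 2) < M := by exact_mod_cast hb
          set M' : ℕ := 2 * (M / 4) with hM'
          set M'' : ℕ := M - M' with hM''
          haveI iM' : NeZero M' := ⟨by omega⟩
          haveI iM'' : NeZero M'' := ⟨by omega⟩
          obtain ⟨e', -⟩ := car L M'
          obtain ⟨e'', -⟩ := car L M''
          obtain ⟨l', p', u'⟩ := ih M' (by omega) ⟨M / 4, by omega⟩ (by omega) L hLe (by omega) hL₀L iL iM'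
            (Fin (L * M')) e'
          obtain ⟨l'', p'', u''⟩ := ih M'' (by omega) ⟨r - M / 4, by omega⟩ (by omega) L hLe (by omega)
            hL₀L iL iM'' (Fin (L * M'')) e''
          obtain ⟨g1, g2, g3⟩ := hB L M' M'' M hLe ⟨M / 4, by omega⟩ ⟨r - M / 4, by omega⟩ (by omega)
            (by omega) (by omega) hML hL₂L (Fin (L * M')) e' (Fin (L * M'')) e'' Λ e
          have hM'0 : (0 : ℝ) < M' := by exact_mod_cast (show 0 < M' by omega)
          have hM''0 : (0 : ℝ) < M'' := by exact_mod_cast (show 0 < M'' by omega)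
          have h2M' : 2 * (M' : ℝ) ≤ M + 2 := by exact_mod_cast (show 2 * M' ≤ M + 2 by omega)
          have h2M'' : 2 * (M'' : ℝ) ≤ M + 2 := by exact_mod_cast (show 2 * M'' ≤ M + 2 by omega)
          have hf : 0 < 1 - a / M := by
            have : a / M < 1 := by rw [div_lt_one hM0]; linarith
            linarith
          have hf' : 0 ≤ 1 + a / M := by positivity
          refine ⟨?_, lt_of_lt_of_le (mul_pos hf (lt_max_of_lt_left (lt_min p' p''))) g2, ?_⟩
          · have c' : d₁ * (1 / 4 + a / (M + 2)) ≤ ρ L M' (Fin (L * M')) e' U δ :=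
              le_trans (mul_le_mul_of_nonneg_left (by linarith [mlo M' M hM'0 h2M']) hp.le) l'
            have c'' : d₁ * (1 / 4 + a / (M + 2)) ≤ ρ L M'' (Fin (L * M'')) e'' U δ :=
              le_trans (mul_le_mul_of_nonneg_left (by linarith [mlo M'' M hM''0 h2M'']) hp.le) l''
            calc d₁ * (1 / 4 + a / (2 * M)) ≤ d₁ * ((1 - a / M) * (1 / 4 + a / (M + 2))) :=
                  mul_le_mul_of_nonneg_left (slo M (by linarith) hM0) hp.le
              _ = (1 - a / M) * (d₁ * (1 / 4 + a / (M + 2))) := by ring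
              _ ≤ _ := (mul_le_mul_of_nonneg_left ((le_min c' c'').trans (le_max_left _ _)) hf.le).trans g1
          · have hB0 : 0 ≤ k₁ * (2 - 8 * a / (M + 2)) := by
              refine mul_nonneg hk0 ?_
              have : 8 * a / ((M : ℝ) + 2) ≤ 1 := by rw [div_le_one (by positivity)]; linarith
              linarith
            have c' : κ L M' (Fin (L * M')) e' U δ ≤ k₁ * (2 - 8 * a / (M + 2)) :=
              u'.trans (mul_le_mul_of_nonneg_left (mhi M' M hM'0 h2M') hk0)
            have c'' : κ L M'' (Fin (L * M'')) e'' U δ ≤ k₁ * (2 - 8 * a / (M + 2)) :=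
              u''.trans (mul_le_mul_of_nonneg_left (mhi M'' M hM''0 h2M'') hk0)
            calc _ ≤ (1 + a / M) * (k₁ * (2 - 8 * a / (M + 2))) :=
                  g3.trans (mul_le_mul_of_nonneg_left (max_le (max_le c' c'') hB0) hf')
              _ = k₁ * ((1 + a / M) * (2 - 8 * a / (M + 2))) := by ring
              _ ≤ k₁ * (2 - 4 * a / M) := mul_le_mul_of_nonneg_left (shi M (by linarith) hM0) hk0
    refine ⟨U, hU, δ, hδ, d₁ / 4, by positivity, 2 * k₁, M₁, L₀, ?_⟩
    intro L M iL iM hLe hMe hM₁M hML hL₀L Λ _ _ e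
    obtain ⟨h1, h2, h3⟩ := main M hMe hM₁M L hLe hML hL₀L iL iM Λ e
    have hM0 : (0 : ℝ) < M := by exact_mod_cast Nat.pos_of_ne_zero (NeZero.ne M)
    have : 0 ≤ a / (2 * M) := by positivity
    have : 0 ≤ 4 * a / M := by positivity
    exact ⟨by nlinarith, h2, by nlinarith⟩
  have hX : WidthUniformThermodynamics := key _ _ h2 h3
  exact Summit.HubbardSuperconductivity.HubbardSuperconductivity.Theses.WidthHaldane.closes h1 hX

end Summit.HubbardSuperconductivity.HubbardSuperconductivity.Theses.SeamInduction
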